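/-
Copyright: the b2b-balaban T⁴-continuum CRUX team, row NE7b leaf lineage `t4-ne7b-formalise-leaf-03` (gen 147). Project licence.
-/
import Literature.Analysis.Convex.AlexandrovSemiconvex
import Mathlib.Analysis.Calculus.ContDiff.Defs

/-!
# A `C²` FUNCTION'S HESSIAN AT A POINT IS READ OFF ANY PEANO EXPANSION — hence THE VALUE HESSIAN IS THE CONSTRAINED SCHUR
# FORM IN HESSIAN CURRENCY: `D²φ(w₀)[h, h] = 2·q(N h) = ⨅_{D v = h} D²V(δ₀)[v, v]` once `φ = ⨅_{Dδ = ·} V δ` is known `C²` at `w₀`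
# (this lineage's `ConstrainedMinimiserRegular.contDiffAt_constrValue`) and its Peano expansion is known
# (`ConstrainedValueSecondOrder.isLittleO_constrValue_secondOrder_of_isMinOn`) — the junction of the two roads of T-85 (L1),
# both inputs DISPLAYED as letters so that the file is Mathlib ∕ Literature-only (row NE7b, node U5c; [folklore])

Cell `pub-balaban`, sub-cell `t4`, spine estimate NE7b (`T4WeightBudget.RelWeightBound`; NOT PRINTED in [Bałaban 1983–89],
NOT PROVED).  Crux-route work under `Spine/NE7b/` by leaf-03 (CRUX team (2), FREEZE (0) crux-prover clause).  NOTHING of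
Bałaban's is named, asserted, valued or discharged.  Imports the BUILT `Literature.Analysis.Convex.AlexandrovSemiconvex`
(`taylor_two_isLittleO_of_hasFDerivAt`) + Mathlib; no `def`; zero `sorry`.

WHY.  T-85 §4 (L1) states the second-order half of (J1) as «`constrValue` is C² at `w₀` AND `D²(constrValue)(w₀)[h, h] =
constrInf (D²V(δ₀)) {v : D v = h}`».  The tree now holds the two halves SEPARATELY: the PEANO expansion
`φ(w₀ + h) = φ w₀ + V′(N h) + q(N h) + o(‖h‖²)` (CVS p378453, quadratic term the constrained Schur form `q ∘ N = q_D`) and the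
REGULARITY `ContDiffAt ℝ 2 φ w₀` (CMR p379513).  What identifies `D²φ(w₀)` with `2q_D` is a calculus fact independent of
constraints: a `C²` function has its own Peano expansion (Taylor) and a function admits at most one expansion with a
bounded 2-homogeneous quadratic term.  CVH (p378676, retry lane) states the uniqueness for an ABSTRACT second-order term `p`;
this file supplies the missing link from `ContDiffAt ℝ 2` to such a `p`, without importing any unbuilt module.

WHAT IS PROVED ([folklore]; Peano's form of Taylor's theorem and uniqueness of the Taylor polynomial, e.g. Dieudonné (8.14.3);
Cartan, *Calcul différentiel* I.5.6):
* §1 `hasFDerivAt_of_peano` — `(h ↦ φ(y + h) − φ y − L h − Q h) =o ‖h‖²` with `|Q h| ≤ C‖h‖²` ⟹ `HasFDerivAt φ L y`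
  (the quadratic term is `O(‖h‖²) = o(‖h‖)`); hence `fderiv_eq_of_peano`: `fderiv ℝ φ y = L`.
* §2 `eq_of_two_homogeneous_isLittleO` — two 2-homogeneous terms `o(‖h‖²)`-apart agree (scaling; the twin of CVH §1's
  `eq_of_isLittleO_sq`, re-derived so that nothing unbuilt is imported).
* §3 **`hessian_apply_eq_of_peano`** — THE IDENTITY: `ContDiffAt ℝ 2 φ y` and a Peano expansion with linear term `L` and a
  bounded 2-homogeneous quadratic term `Q` ⟹ `fderiv ℝ (fderiv ℝ φ) y h h = 2 · Q h` for every `h` (Taylor for `φ` from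
  `ContDiffAt ℝ 2` via `contDiffAt_succ_iff_hasFDerivAt` + `taylor_two_isLittleO_of_hasFDerivAt`; §1 matches the linear
  terms, §2 the quadratic ones).
* §4 **`hessian_constrValue_eq`** — THE (J1) JUNCTION IN HESSIAN CURRENCY, letters displayed: for
  `φ = (w ↦ ⨅ δ : {δ // D δ = w}, V δ)` with `ContDiffAt ℝ 2 φ w₀` (CMR's END) and the expansion
  `(h ↦ φ(w₀ + h) − φ w₀ − V′(N h) − q(N h)) =o ‖h‖²` (CVS's END; `q` 2-homogeneous, `0 ≤ q ≤ c‖·‖²`, `N` continuous linear):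
  `fderiv ℝ φ w₀ = V′ ∘ N` (the multiplier, CVD) and `fderiv ℝ (fderiv ℝ φ) w₀ h h = 2 · q (N h)` — with `q = ½D²V(δ₀)[·,·]`:
  `D²φ(w₀)[h, h] = D²V(δ₀)[N h, N h] = ⨅_{D v = h} D²V(δ₀)[v, v]` (CVS `constrInf_eq_apply_fibreMin` for the last name);
  **`hessian_constrValueG_eq`** — the NONLINEAR-constraint twin in CVL's currency `{δ // G δ = w}`: `Dφ(w₀) = Λ` (the multiplier)
  and `D²φ(w₀)[h, h] = 2·𝓛(N h)` from CMRN's `C²` letter and CVL's Lagrangian Peano expansion (T-85 (E2) in Hessian currency).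
* §5 toy (`example`): `φ = ‖·‖²`-free scalar check `φ x = x²` on `ℝ`: Peano term `Q h = h²`, Hessian `2`.

NOT HERE (honest): the two displayed letters themselves (CMR ∕ CVS, landed; this file meets them by name — a three-line
`obtain`/`exact` at any consumer, or a junction file once their oleans exist); mixed second derivatives `D²φ(w₀)[h, k]`
(polarisation, one more line when needed); (A3) ∕ (A1c).  BY-NAME EFFECT ON THE WALL: NONE.  NE7b NOT PRINTED ∕ NOT PROVED;
spine PROVED 0∕9; rung (B)+1 on a FINITE torus — NOT infinite volume, NOT the mass gap, NOT Clay.  HONEST DEPENDENCY: continuum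
YM on T⁴ ⇐ BetaPertH ∧ nine spine estimates (0/9 proved); BetaPertH ⇐ (D1) ∧ (D4) ∧ CAP+tail; G-an2-4 gates asym, D1 and
NE2∕3∕4.
-/

set_option autoImplicit false

noncomputable section

namespace Summit.QuantumFields.BalabanUV.T4Continuum.NE7b.PeanoHessianIdentity

open Set Filter Topology Function Asymptotics Metric

variable {F : Type*} [NormedAddCommGroup F] [NormedSpace ℝ F]

/-! ## §1. A Peano expansion determines the derivative -/

/-- **A PEANO EXPANSION GIVES THE DERIVATIVE**: `(h ↦ φ(y + h) − φ y − L h − Q h) =o[𝓝 0] ‖h‖²` with `|Q h| ≤ C‖h‖²` ⟹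
`HasFDerivAt φ L y`. [folklore] -/
theorem hasFDerivAt_of_peano {φ : F → ℝ} {L : F →L[ℝ] ℝ} {Q : F → ℝ} {y : F} {C : ℝ} (hQ : ∀ h, |Q h| ≤ C * ‖h‖ ^ 2)
    (hexp : (fun h => φ (y + h) - φ y - L h - Q h) =o[𝓝 (0 : F)] fun h => ‖h‖ ^ 2) : HasFDerivAt φ L y := by
  have hsq : (fun v : F => ‖v‖ ^ 2) =o[𝓝 (0 : F)] fun v => v := by
    refine isLittleO_iff.2 fun ε hε => Metric.eventually_nhds_iff.2 ⟨ε, hε, fun v hv => ?_⟩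
    rw [dist_zero_right] at hv
    rw [Real.norm_of_nonneg (by positivity), sq]
    exact mul_le_mul_of_nonneg_right hv.le (norm_nonneg _)
  have hq : (fun v => Q v) =O[𝓝 (0 : F)] fun v => ‖v‖ ^ 2 := by
    refine IsBigO.of_bound (max C 0) (Eventually.of_forall fun v => ?_)
    rw [Real.norm_eq_abs, Real.norm_of_nonneg (by positivity)]
    exact (hQ v).trans (by gcongr; exact le_max_left _ _)
  have h1 : (fun v => φ (y + v) - φ y - L v) =o[𝓝 (0 : F)] fun v => v := by
    have h2 := (hexp.add_isBigO hq).trans_isLittleO hsq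
    refine h2.congr' (Eventually.of_forall fun v => ?_) EventuallyEq.rfl
    dsimp only
    ring
  exact hasFDerivAt_iff_isLittleO_nhds_zero.2 h1

/-- Hence `fderiv ℝ φ y = L`. [folklore] -/
theorem fderiv_eq_of_peano {φ : F → ℝ} {L : F →L[ℝ] ℝ} {Q : F → ℝ} {y : F} {C : ℝ} (hQ : ∀ h, |Q h| ≤ C * ‖h‖ ^ 2)
    (hexp : (fun h => φ (y + h) - φ y - L h - Q h) =o[𝓝 (0 : F)] fun h => ‖h‖ ^ 2) : fderiv ℝ φ y = L :=
  (hasFDerivAt_of_peano hQ hexp).fderiv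

/-! ## §2. Two 2-homogeneous terms `o(‖h‖²)`-apart agree -/

/-- **AT MOST ONE 2-HOMOGENEOUS SECOND-ORDER TERM**: `p`, `p′` with `p (t • h) = t² p h` (same for `p′`) and
`(h ↦ p h − p′ h) =o[𝓝 0] ‖h‖²` ⟹ `p = p′` pointwise (scale `h` into the small ball; both sides scale like `t²`). [folklore] -/
theorem eq_of_two_homogeneous_isLittleO {p p' : F → ℝ} (hp : ∀ (t : ℝ) (h : F), p (t • h) = t ^ 2 * p h)
    (hp' : ∀ (t : ℝ) (h : F), p' (t • h) = t ^ 2 * p' h)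
    (hpp' : (fun h => p h - p' h) =o[𝓝 (0 : F)] fun h => ‖h‖ ^ 2) (h : F) : p h = p' h := by
  by_contra hne
  have hh : h ≠ 0 := by
    rintro rfl
    have h0 : p 0 = 0 := by simpa using hp 0 0
    have h0' : p' 0 = 0 := by simpa using hp' 0 0
    exact hne (by rw [h0, h0'])
  have hd : 0 < |p h - p' h| := abs_pos.2 (sub_ne_zero.2 hne)
  have hnh : 0 < ‖h‖ := norm_pos_iff.2 hh
  have hε : 0 < |p h - p' h| / (2 * ‖h‖ ^ 2) := by positivity
  obtain ⟨r, hr, hball⟩ := Metric.eventually_nhds_iff.1 (hpp'.def hε)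
  set t : ℝ := r / (2 * ‖h‖) with ht
  have htpos : 0 < t := by positivity
  have hnorm : ‖t • h‖ = t * ‖h‖ := by rw [norm_smul, Real.norm_of_nonneg htpos.le]
  have hth : t * ‖h‖ = r / 2 := by
    rw [ht]
    field_simp
  have hk := hball (show dist (t • h) 0 < r by rw [dist_zero_right, hnorm, hth]; linarith)
  have hlhs : ‖p (t • h) - p' (t • h)‖ = t ^ 2 * |p h - p' h| := by
    rw [hp, hp', ← mul_sub, Real.norm_eq_abs, abs_mul, abs_of_nonneg (sq_nonneg t)]
  have hrhs : ‖‖t • h‖ ^ 2‖ = t ^ 2 * ‖h‖ ^ 2 := by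
    rw [Real.norm_of_nonneg (sq_nonneg _), hnorm, mul_pow]
  rw [hlhs, hrhs] at hk
  have h1 : |p h - p' h| / (2 * ‖h‖ ^ 2) * (t ^ 2 * ‖h‖ ^ 2) = t ^ 2 * (|p h - p' h| / 2) := by
    field_simp
  rw [h1] at hk
  have h2 : 0 < t ^ 2 := by positivity
  have h3 : |p h - p' h| ≤ |p h - p' h| / 2 := le_of_mul_le_mul_left hk h2
  linarith

/-! ## §3. The Hessian of a `C²` function is read off any Peano expansion -/

/-- A `C²` function has its own Peano expansion at `y` with the Hessian as quadratic term:
`(h ↦ φ(y + h) − φ y − Dφ(y) h − ½ D²φ(y)[h, h]) =o ‖h‖²`. [folklore] -/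
theorem taylor_two_of_contDiffAt {φ : F → ℝ} {y : F} (hφ : ContDiffAt ℝ 2 φ y) :
    (fun h => φ (y + h) - φ y - fderiv ℝ φ y h - fderiv ℝ (fderiv ℝ φ) y h h / 2)
      =o[𝓝 (0 : F)] fun h => ‖h‖ ^ 2 := by
  have h1 : ∀ᶠ z in 𝓝 y, HasFDerivAt φ (fderiv ℝ φ z) z := by
    have hd : ∀ᶠ z in 𝓝 y, DifferentiableAt ℝ φ z :=
      (hφ.eventually (by simp)).mono fun z hz => hz.differentiableAt (by simp)
    exact hd.mono fun z hz => hz.hasFDerivAt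
  have h2 : HasFDerivAt (fderiv ℝ φ) (fderiv ℝ (fderiv ℝ φ) y) y := by
    have hd1 : ContDiffAt ℝ 1 (fderiv ℝ φ) y := hφ.fderiv_right (by norm_num)
    exact (hd1.differentiableAt (by simp)).hasFDerivAt
  exact Literature.Analysis.Convex.taylor_two_isLittleO_of_hasFDerivAt h1 h2

/-- **THE HESSIAN IS READ OFF ANY PEANO EXPANSION**: `φ` of class `C²` at `y` and
`(h ↦ φ(y + h) − φ y − L h − Q h) =o ‖h‖²` with `Q` 2-homogeneous and `|Q h| ≤ C‖h‖²` ⟹ `D²φ(y)[h, h] = 2·Q h` for all `h`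
(and `Dφ(y) = L`, §1). [folklore] -/
theorem hessian_apply_eq_of_peano {φ : F → ℝ} {L : F →L[ℝ] ℝ} {Q : F → ℝ} {y : F} {C : ℝ} (hφ : ContDiffAt ℝ 2 φ y)
    (hQ2 : ∀ (t : ℝ) (h : F), Q (t • h) = t ^ 2 * Q h) (hQ : ∀ h, |Q h| ≤ C * ‖h‖ ^ 2)
    (hexp : (fun h => φ (y + h) - φ y - L h - Q h) =o[𝓝 (0 : F)] fun h => ‖h‖ ^ 2) (h : F) :
    fderiv ℝ (fderiv ℝ φ) y h h = 2 * Q h := by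
  have hL : fderiv ℝ φ y = L := fderiv_eq_of_peano hQ hexp
  have htay := taylor_two_of_contDiffAt hφ
  rw [hL] at htay
  -- the two quadratic terms are `o(‖h‖²)` apart
  have hdiff : (fun h => fderiv ℝ (fderiv ℝ φ) y h h / 2 - Q h) =o[𝓝 (0 : F)] fun h => ‖h‖ ^ 2 := by
    refine (hexp.sub htay).congr' (Eventually.of_forall fun h => ?_) EventuallyEq.rfl
    dsimp only
    ring
  have hhom : ∀ (t : ℝ) (h : F), fderiv ℝ (fderiv ℝ φ) y (t • h) (t • h) / 2 = t ^ 2 * (fderiv ℝ (fderiv ℝ φ) y h h / 2) :=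
    fun t h => by simp only [map_smul, FunLike.coe_smul, Pi.smul_apply, smul_eq_mul]; ring
  have heq := eq_of_two_homogeneous_isLittleO hhom hQ2 hdiff h
  linarith

/-! ## §4. The (J1) junction in Hessian currency: the value Hessian is the constrained Schur form -/

variable {E : Type*} [NormedAddCommGroup E] [NormedSpace ℝ E]

/-- **`D²φ(w₀)[h, h] = 2·q(N h)` AND `Dφ(w₀) = V′ ∘ N` FOR THE HARD-CONSTRAINT VALUE** — letters displayed:
`φ = (w ↦ ⨅ δ : {δ // D δ = w}, V δ)` of class `C²` at `w₀` (this lineage's `ConstrainedMinimiserRegular.contDiffAt_constrValue`)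
with the Peano expansion `(h ↦ φ(w₀ + h) − φ w₀ − V′(N h) − q(N h)) =o ‖h‖²`
(`ConstrainedValueSecondOrder.isLittleO_constrValue_secondOrder_of_isMinOn`; `q` 2-homogeneous with `0 ≤ q ≤ c‖·‖²`, `N`
continuous linear).  With `q v = ½ D²V(δ₀)[v, v]` and `N` the `q`-minimising right inverse this reads
`D²φ(w₀)[h, h] = D²V(δ₀)[N h, N h] = ⨅_{D v = h} D²V(δ₀)[v, v]` — T-85 (L1) in Hessian currency. [folklore] -/
theorem hessian_constrValue_eq {V : E → ℝ} {D : E →L[ℝ] F} {V' : E →L[ℝ] ℝ} {N : F →L[ℝ] E} {q : E → ℝ} {w₀ : F}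
    (hφ2 : ContDiffAt ℝ 2 (fun w => ⨅ δ : {δ // D δ = w}, V δ.1) w₀)
    (hq2 : ∀ (t : ℝ) (v : E), q (t • v) = t ^ 2 * q v) (hq0 : ∀ v, 0 ≤ q v) {c : ℝ} (hqc : ∀ v, q v ≤ c * ‖v‖ ^ 2)
    (hexp : (fun h => (⨅ δ : {δ // D δ = w₀ + h}, V δ.1) - (⨅ δ : {δ // D δ = w₀}, V δ.1) - V' (N h) - q (N h))
      =o[𝓝 (0 : F)] fun h => ‖h‖ ^ 2) :
    fderiv ℝ (fun w => ⨅ δ : {δ // D δ = w}, V δ.1) w₀ = V'.comp N ∧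
      ∀ h : F, fderiv ℝ (fderiv ℝ (fun w => ⨅ δ : {δ // D δ = w}, V δ.1)) w₀ h h = 2 * q (N h) := by
  -- the quadratic term `Q h = q (N h)` is 2-homogeneous and bounded by `max c 0 · ‖N‖² · ‖h‖²`
  have hQ2 : ∀ (t : ℝ) (h : F), q (N (t • h)) = t ^ 2 * q (N h) := fun t h => by rw [map_smul, hq2]
  have hQ : ∀ h : F, |q (N h)| ≤ max c 0 * ‖N‖ ^ 2 * ‖h‖ ^ 2 := fun h => by
    rw [abs_of_nonneg (hq0 _)]
    have h1 : q (N h) ≤ max c 0 * ‖N h‖ ^ 2 :=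
      (hqc _).trans (mul_le_mul_of_nonneg_right (le_max_left _ _) (sq_nonneg _))
    have h2 : ‖N h‖ ^ 2 ≤ (‖N‖ * ‖h‖) ^ 2 := pow_le_pow_left₀ (norm_nonneg _) (N.le_opNorm h) 2
    calc q (N h) ≤ max c 0 * ‖N h‖ ^ 2 := h1
      _ ≤ max c 0 * (‖N‖ * ‖h‖) ^ 2 := mul_le_mul_of_nonneg_left h2 (le_max_right _ _)
      _ = max c 0 * ‖N‖ ^ 2 * ‖h‖ ^ 2 := by ring
  have hexp' : (fun h => (⨅ δ : {δ // D δ = w₀ + h}, V δ.1) - (⨅ δ : {δ // D δ = w₀}, V δ.1) - (V'.comp N) h - q (N h))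
      =o[𝓝 (0 : F)] fun h => ‖h‖ ^ 2 := by
    simpa only [ContinuousLinearMap.comp_apply] using hexp
  exact ⟨fderiv_eq_of_peano hQ hexp', fun h => hessian_apply_eq_of_peano hφ2 hQ2 hQ hexp' h⟩

/-- **NONLINEAR CONSTRAINT: `Dφ(w₀) = Λ` AND `D²φ(w₀)[h, h] = 2·𝓛(N h)`** — letters displayed: the value on the nonlinear fibres
`φ = (w ↦ ⨅ δ : {δ // G δ = w}, V δ)` of class `C²` at `w₀` (this lineage's `ConstrainedMinimiserRegularNonlinear`) with the
LAGRANGIAN Peano expansion `(h ↦ φ(w₀ + h) − φ w₀ − Λ h − 𝓛(N h)) =o ‖h‖²` (`ConstrainedValueLagrangian.isLittleO_constrValue_lagrangian`;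
`𝓛 = q − s` the Lagrangian form, here any 2-homogeneous `𝓛` with `|𝓛 v| ≤ C‖v‖²`, `N` continuous linear): the multiplier IS
the derivative and the value Hessian is `2·𝓛 ∘ N` = the constrained Schur complement of the LAGRANGIAN Hessian — T-85 (E2) in
Hessian currency. [folklore] -/
theorem hessian_constrValueG_eq {V : E → ℝ} {G : E → F} {Λ : F →L[ℝ] ℝ} {N : F →L[ℝ] E} {L : E → ℝ} {w₀ : F}
    (hφ2 : ContDiffAt ℝ 2 (fun w => ⨅ δ : {δ // G δ = w}, V δ.1) w₀)
    (hL2 : ∀ (t : ℝ) (v : E), L (t • v) = t ^ 2 * L v) {C : ℝ} (hLc : ∀ v, |L v| ≤ C * ‖v‖ ^ 2)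
    (hexp : (fun h => (⨅ δ : {δ // G δ = w₀ + h}, V δ.1) - (⨅ δ : {δ // G δ = w₀}, V δ.1) - Λ h - L (N h))
      =o[𝓝 (0 : F)] fun h => ‖h‖ ^ 2) :
    fderiv ℝ (fun w => ⨅ δ : {δ // G δ = w}, V δ.1) w₀ = Λ ∧
      ∀ h : F, fderiv ℝ (fderiv ℝ (fun w => ⨅ δ : {δ // G δ = w}, V δ.1)) w₀ h h = 2 * L (N h) := by
  have hQ2 : ∀ (t : ℝ) (h : F), L (N (t • h)) = t ^ 2 * L (N h) := fun t h => by rw [map_smul, hL2]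
  have hQ : ∀ h : F, |L (N h)| ≤ max C 0 * ‖N‖ ^ 2 * ‖h‖ ^ 2 := fun h => by
    have h1 : |L (N h)| ≤ max C 0 * ‖N h‖ ^ 2 :=
      (hLc _).trans (mul_le_mul_of_nonneg_right (le_max_left _ _) (sq_nonneg _))
    have h2 : ‖N h‖ ^ 2 ≤ (‖N‖ * ‖h‖) ^ 2 := pow_le_pow_left₀ (norm_nonneg _) (N.le_opNorm h) 2
    calc |L (N h)| ≤ max C 0 * ‖N h‖ ^ 2 := h1
      _ ≤ max C 0 * (‖N‖ * ‖h‖) ^ 2 := mul_le_mul_of_nonneg_left h2 (le_max_right _ _)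
      _ = max C 0 * ‖N‖ ^ 2 * ‖h‖ ^ 2 := by ring
  exact ⟨fderiv_eq_of_peano hQ hexp, fun h => hessian_apply_eq_of_peano hφ2 hQ2 hQ hexp h⟩

/-! ## §5. Toy -/

/-- Toy: `φ x = x²` on `ℝ` at `y`: Peano expansion with `L h = 2yh`, `Q h = h²` (exact, remainder `0`), `φ ∈ C²`; the
identity returns `D²φ(y)[h, h] = 2h²`. [folklore] -/
example (y h : ℝ) : fderiv ℝ (fderiv ℝ fun x : ℝ => x ^ 2) y h h = 2 * h ^ 2 := by
  have hφ : ContDiffAt ℝ 2 (fun x : ℝ => x ^ 2) y := (contDiff_id.pow 2).contDiffAt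
  refine hessian_apply_eq_of_peano (L := (2 * y) • ContinuousLinearMap.id ℝ ℝ) (Q := fun h => h ^ 2) (C := 1) hφ
    (fun t h => by simp [mul_pow]) (fun h => by rw [abs_of_nonneg (sq_nonneg h), Real.norm_eq_abs, sq_abs, one_mul]) ?_ h
  refine (isLittleO_zero _ _).congr' (Eventually.of_forall fun h => ?_) EventuallyEq.rfl
  simp only [FunLike.coe_smul, Pi.smul_apply, ContinuousLinearMap.coe_id', id_eq, smul_eq_mul]
  ring

end Summit.QuantumFields.BalabanUV.T4Continuum.NE7b.PeanoHessianIdentity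

end
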